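import Mathlib
import Summits.NavierStokesRegularity.NavierStokesRegularity.Theorems.WakeRatchetTailRatchetRelayFrozenDilation
import HarnessLib

/-!
# `WakeRatchet.TailRatchet` (stmt-NavierStokesRegularity-21808): LIPSCHITZ DEPENDENCE OF THE FRONT FORCING
# ON THE TIME RATIO `s` (away from `s = 2`)

Support file for the crux `TailRatchet` (route `WakeRatchet`; MODEL lattice ODEs of Tao 2016 §1.2, §4 —
nothing in this file is a statement about the Navier–Stokes equations, and no item is closed here).

Context (census of stmt-21808, programme R-lac → continuation): to follow the lacunary branch `s ↦ (h_s, δ_s)`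
of exact scalar dyadic fronts CONTINUOUSLY in `s` one needs the forcing `N_s(h, δ)` of the Picard map
(`…RelayNonlinearMap`) to be Lipschitz in `s` in the weighted class `|·| ≤ C e^{t/2}`.  The dilations `t/s`
halve decay rates, so the quadratic term `(4/s²)h(t/s)²` is exactly critical at `s = 2`; for `s ≤ σ < 2` the
spare decay `e^{(1/σ − 1/2)t}` absorbs the factor `|t|` produced by differentiating a dilation.  This file
proves, for `3/2 ≤ s₁, s₂ ≤ σ < 2` and a state `|h|, |h'| ≤ r e^{ξ/2}`, `|δ| ≤ r`:

* `inv_sub_inv_abs_le`, `inv_sq_sub_inv_sq_abs_le` — arithmetic of two time ratios in `[3/2, 2]`;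
* `residual_lipschitz_s` — the residual term (`≤ 6|s₁−s₂|e^{t/2}`);
* `linear_lipschitz_s` — the dilated linear term (`≤ 16r|s₁−s₂|e^{t/2}`).

The quadratic and drain terms and the assembled bound `forcing_lipschitz_s` are in the companion file
`…RelayDilationLipschitzForcing`.

HONEST FRAMING: elementary inequalities; MODEL lattice only; lacunary fronts (LARGE `ε₀`) do NOT refute
`TailRatchet` (which needs `Λ → 1`); the construction item and the crux stay open.
-/

noncomputable section

set_option linter.dupNamespace false

namespace Summit.NavierStokesRegularity.NavierStokesRegularity.Theorems

namespace WakeRatchetRelayDilationLipschitz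

open Set Filter Topology
open WakeRatchetRelayFrozenDilation

/-! ## Elementary facts about two time ratios in `[3/2, 2]` -/

/-- `|1/s₁ − 1/s₂| ≤ (4/9)|s₁ − s₂|` for `s₁, s₂ ≥ 3/2`. [folklore] -/
theorem inv_sub_inv_abs_le {s₁ s₂ : ℝ} (h₁ : 3 / 2 ≤ s₁) (h₂ : 3 / 2 ≤ s₂) :
    |1 / s₁ - 1 / s₂| ≤ 4 / 9 * |s₁ - s₂| := by
  have hs₁ : 0 < s₁ := by linarith
  have hs₂ : 0 < s₂ := by linarith
  rw [div_sub_div _ _ hs₁.ne' hs₂.ne', abs_div, one_mul, mul_one, abs_of_pos (mul_pos hs₁ hs₂),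
    abs_sub_comm, div_le_iff₀ (mul_pos hs₁ hs₂)]
  have : (9 : ℝ) / 4 ≤ s₁ * s₂ := by nlinarith
  nlinarith [abs_nonneg (s₁ - s₂)]

/-- `|1/s₁² − 1/s₂²| ≤ |s₁ − s₂|` for `3/2 ≤ s₁, s₂ ≤ 2`. [folklore] -/
theorem inv_sq_sub_inv_sq_abs_le {s₁ s₂ : ℝ} (h₁ : 3 / 2 ≤ s₁) (h₁' : s₁ ≤ 2) (h₂ : 3 / 2 ≤ s₂)
    (h₂' : s₂ ≤ 2) : |1 / s₁ ^ 2 - 1 / s₂ ^ 2| ≤ |s₁ - s₂| := by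
  have hs₁ : 0 < s₁ := by linarith
  have hs₂ : 0 < s₂ := by linarith
  have hp : 0 < s₁ ^ 2 * s₂ ^ 2 := by positivity
  rw [div_sub_div _ _ (by positivity) (by positivity), abs_div, one_mul, mul_one, abs_of_pos hp,
    div_le_iff₀ hp]
  have hfac : s₂ ^ 2 - s₁ ^ 2 = (s₂ - s₁) * (s₂ + s₁) := by ring
  rw [hfac, abs_mul, abs_sub_comm, abs_of_pos (by linarith : 0 < s₂ + s₁)]
  have h81 : (81 : ℝ) / 16 ≤ s₁ ^ 2 * s₂ ^ 2 := by
    have : (9 : ℝ) / 4 ≤ s₁ * s₂ := by nlinarith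
    nlinarith
  nlinarith [abs_nonneg (s₁ - s₂)]

/-! ## The residual term -/

/-- `|(4/s₁²)e^{2t/s₁} − (4/s₂²)e^{2t/s₂}| ≤ 6|s₁−s₂|e^{t/2}` for `3/2 ≤ sᵢ ≤ 2`, `t < 0`. [folklore] -/
theorem residual_lipschitz_s {s₁ s₂ : ℝ} (h₁ : 3 / 2 ≤ s₁) (h₁' : s₁ ≤ 2) (h₂ : 3 / 2 ≤ s₂)
    (h₂' : s₂ ≤ 2) {t : ℝ} (ht : t < 0) :
    |4 / s₁ ^ 2 * Real.exp (2 * t / s₁) - 4 / s₂ ^ 2 * Real.exp (2 * t / s₂)| ≤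
      6 * |s₁ - s₂| * Real.exp (t / 2) := by
  have hs₁ : 0 < s₁ := by linarith
  have hs₂ : 0 < s₂ := by linarith
  set Δ := |s₁ - s₂| with hΔ
  have hΔ0 : 0 ≤ Δ := abs_nonneg _
  -- exponents are `≤ t`
  have he₁ : 2 * t / s₁ ≤ t := by rw [div_le_iff₀ hs₁]; nlinarith
  have he₂ : 2 * t / s₂ ≤ t := by rw [div_le_iff₀ hs₂]; nlinarith
  have hexp₁ : Real.exp (2 * t / s₁) ≤ Real.exp t := Real.exp_le_exp.2 he₁
  have het : Real.exp t ≤ Real.exp (t / 2) := Real.exp_le_exp.2 (by linarith)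
  have hsplit : 4 / s₁ ^ 2 * Real.exp (2 * t / s₁) - 4 / s₂ ^ 2 * Real.exp (2 * t / s₂) =
      4 * (1 / s₁ ^ 2 - 1 / s₂ ^ 2) * Real.exp (2 * t / s₁) +
        4 / s₂ ^ 2 * (Real.exp (2 * t / s₁) - Real.exp (2 * t / s₂)) := by ring
  rw [hsplit]
  have hA : |4 * (1 / s₁ ^ 2 - 1 / s₂ ^ 2) * Real.exp (2 * t / s₁)| ≤ 4 * Δ * Real.exp (t / 2) := by
    rw [abs_mul, abs_mul, abs_of_pos (by norm_num : (0 : ℝ) < 4), abs_of_pos (Real.exp_pos _)]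
    exact mul_le_mul (mul_le_mul_of_nonneg_left (inv_sq_sub_inv_sq_abs_le h₁ h₁' h₂ h₂') (by norm_num))
      (hexp₁.trans het) (Real.exp_pos _).le (by positivity)
  have hB : |4 / s₂ ^ 2 * (Real.exp (2 * t / s₁) - Real.exp (2 * t / s₂))| ≤ 2 * Δ * Real.exp (t / 2) := by
    rw [abs_mul, abs_of_pos (by positivity : (0 : ℝ) < 4 / s₂ ^ 2)]
    have h49 : 4 / s₂ ^ 2 ≤ (16 : ℝ) / 9 := by
      rw [div_le_div_iff₀ (by positivity) (by norm_num)]; nlinarith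
    have hdiff : |2 * t / s₁ - 2 * t / s₂| ≤ 8 / 9 * |t| * Δ := by
      have : 2 * t / s₁ - 2 * t / s₂ = 2 * t * (1 / s₁ - 1 / s₂) := by ring
      rw [this, abs_mul, abs_mul, abs_two]
      have := inv_sub_inv_abs_le h₁ h₂
      nlinarith [abs_nonneg t, abs_nonneg (1 / s₁ - 1 / s₂)]
    have hmv := exp_sub_exp_abs_le he₁ he₂
    have hte : |t| * Real.exp t ≤ Real.exp (t / 2) := by
      have h1 : |t| * Real.exp (1 / 2 * t) ≤ 1 / (2 * (1 / 2)) := abs_mul_exp_mul_le (by norm_num) ht.le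
      have h2 : Real.exp t = Real.exp (1 / 2 * t) * Real.exp (t / 2) := by
        rw [← Real.exp_add]; ring_nf
      rw [h2, ← mul_assoc]
      calc |t| * Real.exp (1 / 2 * t) * Real.exp (t / 2) ≤ 1 / (2 * (1 / 2)) * Real.exp (t / 2) :=
          mul_le_mul_of_nonneg_right h1 (Real.exp_pos _).le
        _ = Real.exp (t / 2) := by norm_num
    calc 4 / s₂ ^ 2 * |Real.exp (2 * t / s₁) - Real.exp (2 * t / s₂)|
        ≤ 16 / 9 * (Real.exp t * (8 / 9 * |t| * Δ)) :=
          mul_le_mul h49 (hmv.trans (mul_le_mul_of_nonneg_left hdiff (Real.exp_pos _).le))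
            (abs_nonneg _) (by norm_num)
      _ = 128 / 81 * Δ * (|t| * Real.exp t) := by ring
      _ ≤ 128 / 81 * Δ * Real.exp (t / 2) := mul_le_mul_of_nonneg_left hte (by positivity)
      _ ≤ 2 * Δ * Real.exp (t / 2) := by nlinarith [Real.exp_pos (t / 2)]
  calc _ ≤ |4 * (1 / s₁ ^ 2 - 1 / s₂ ^ 2) * Real.exp (2 * t / s₁)| +
        |4 / s₂ ^ 2 * (Real.exp (2 * t / s₁) - Real.exp (2 * t / s₂))| := abs_add_le _ _
    _ ≤ 4 * Δ * Real.exp (t / 2) + 2 * Δ * Real.exp (t / 2) := add_le_add hA hB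
    _ = 6 * Δ * Real.exp (t / 2) := by ring

/-! ## The linear (dilated) term -/

/-- `|(8/s₁²)e^{t/s₁}h(t/s₁) − (8/s₂²)e^{t/s₂}h(t/s₂)| ≤ 16 r |s₁−s₂| e^{t/2}` for a state with
`|h| ≤ re^{ξ/2}` (`ξ ≤ 0`), `|h'| ≤ re^{ξ/2}` (`ξ < 0`), `3/2 ≤ sᵢ ≤ 2`, `t < 0`. [folklore] -/
theorem linear_lipschitz_s {s₁ s₂ r : ℝ} (h₁ : 3 / 2 ≤ s₁) (h₁' : s₁ ≤ 2) (h₂ : 3 / 2 ≤ s₂)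
    (h₂' : s₂ ≤ 2) {h h' : ℝ → ℝ}
    (hd : ∀ ξ : ℝ, ξ < 0 → HasDerivAt h (h' ξ) ξ)
    (hρ : ∀ ξ : ℝ, ξ ≤ 0 → |h ξ| ≤ r * Real.exp (ξ / 2))
    (hD : ∀ ξ : ℝ, ξ < 0 → |h' ξ| ≤ r * Real.exp (ξ / 2)) {t : ℝ} (ht : t < 0) :
    |8 / s₁ ^ 2 * Real.exp (t / s₁) * h (t / s₁) - 8 / s₂ ^ 2 * Real.exp (t / s₂) * h (t / s₂)| ≤
      16 * r * |s₁ - s₂| * Real.exp (t / 2) := by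
  have hs₁ : 0 < s₁ := by linarith
  have hs₂ : 0 < s₂ := by linarith
  have hr0 : 0 ≤ r := by
    have := hρ 0 le_rfl; rw [zero_div, Real.exp_zero, mul_one] at this; exact (abs_nonneg _).trans this
  set Δ := |s₁ - s₂| with hΔ
  have hΔ0 : 0 ≤ Δ := abs_nonneg _
  have e2 : 0 < Real.exp (t / 2) := Real.exp_pos _
  -- the dilated points
  have ha : t / s₁ ≤ t / 2 := by rw [div_le_div_iff₀ hs₁ (by norm_num)]; nlinarith
  have hb : t / s₂ ≤ t / 2 := by rw [div_le_div_iff₀ hs₂ (by norm_num)]; nlinarith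
  have ha0 : t / s₁ ≤ 0 := by linarith
  have hb0 : t / s₂ ≤ 0 := by linarith
  have ht2 : t / 2 < 0 := by linarith
  have hab : |t / s₁ - t / s₂| ≤ 4 / 9 * |t| * Δ := by
    have : t / s₁ - t / s₂ = t * (1 / s₁ - 1 / s₂) := by ring
    rw [this, abs_mul]
    have := inv_sub_inv_abs_le h₁ h₂
    nlinarith [abs_nonneg t, abs_nonneg (1 / s₁ - 1 / s₂)]
  -- exponential factors
  have hex₁ : Real.exp (t / s₁) ≤ Real.exp (t / 2) := Real.exp_le_exp.2 ha
  have hex₂ : Real.exp (t / s₂) ≤ Real.exp (t / 2) := Real.exp_le_exp.2 hb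
  -- `|h(t/s₁)| ≤ r e^{t/4}`, `|h(t/sᵢ)| ≤ r`
  have hh₁ : |h (t / s₁)| ≤ r * Real.exp (t / 4) := (hρ _ ha0).trans
    (mul_le_mul_of_nonneg_left (Real.exp_le_exp.2 (by linarith)) hr0)
  have hh₁' : |h (t / s₁)| ≤ r := hh₁.trans (by
    have : Real.exp (t / 4) ≤ 1 := Real.exp_le_one_iff.2 (by linarith); nlinarith)
  -- `|t| e^{t/4} ≤ 2`
  have hte : |t| * Real.exp (t / 4) ≤ 2 := by
    have := abs_mul_exp_mul_le (c := 1 / 4) (by norm_num) ht.le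
    rw [show (1 : ℝ) / 4 * t = t / 4 by ring] at this
    exact this.trans (by norm_num)
  -- split into three pieces
  have hsplit : 8 / s₁ ^ 2 * Real.exp (t / s₁) * h (t / s₁) - 8 / s₂ ^ 2 * Real.exp (t / s₂) * h (t / s₂) =
      8 * (1 / s₁ ^ 2 - 1 / s₂ ^ 2) * (Real.exp (t / s₁) * h (t / s₁)) +
      8 / s₂ ^ 2 * (Real.exp (t / s₁) - Real.exp (t / s₂)) * h (t / s₁) +
      8 / s₂ ^ 2 * Real.exp (t / s₂) * (h (t / s₁) - h (t / s₂)) := by ring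
  rw [hsplit]
  have h49 : 8 / s₂ ^ 2 ≤ (32 : ℝ) / 9 := by
    rw [div_le_div_iff₀ (by positivity) (by norm_num)]; nlinarith
  have hP1 : |8 * (1 / s₁ ^ 2 - 1 / s₂ ^ 2) * (Real.exp (t / s₁) * h (t / s₁))| ≤ 8 * r * Δ * Real.exp (t / 2) := by
    rw [abs_mul, abs_mul, abs_of_pos (by norm_num : (0 : ℝ) < 8), abs_mul, abs_of_pos (Real.exp_pos _)]
    have h1 := inv_sq_sub_inv_sq_abs_le h₁ h₁' h₂ h₂'
    have h2 : Real.exp (t / s₁) * |h (t / s₁)| ≤ Real.exp (t / 2) * r :=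
      mul_le_mul hex₁ hh₁' (abs_nonneg _) e2.le
    calc 8 * |1 / s₁ ^ 2 - 1 / s₂ ^ 2| * (Real.exp (t / s₁) * |h (t / s₁)|) ≤ 8 * Δ * (Real.exp (t / 2) * r) :=
        mul_le_mul (mul_le_mul_of_nonneg_left h1 (by norm_num)) h2 (by positivity) (by positivity)
      _ = 8 * r * Δ * Real.exp (t / 2) := by ring
  have hP2 : |8 / s₂ ^ 2 * (Real.exp (t / s₁) - Real.exp (t / s₂)) * h (t / s₁)| ≤
      4 * r * Δ * Real.exp (t / 2) := by
    rw [abs_mul, abs_mul, abs_of_pos (by positivity : (0 : ℝ) < 8 / s₂ ^ 2)]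
    have hmv : |Real.exp (t / s₁) - Real.exp (t / s₂)| ≤ Real.exp (t / 2) * (4 / 9 * |t| * Δ) :=
      (exp_sub_exp_abs_le ha hb).trans (mul_le_mul_of_nonneg_left hab e2.le)
    calc 8 / s₂ ^ 2 * |Real.exp (t / s₁) - Real.exp (t / s₂)| * |h (t / s₁)|
        ≤ 32 / 9 * (Real.exp (t / 2) * (4 / 9 * |t| * Δ)) * (r * Real.exp (t / 4)) :=
          mul_le_mul (mul_le_mul h49 hmv (abs_nonneg _) (by norm_num)) hh₁ (abs_nonneg _) (by positivity)
      _ = 128 / 81 * r * Δ * Real.exp (t / 2) * (|t| * Real.exp (t / 4)) := by ring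
      _ ≤ 128 / 81 * r * Δ * Real.exp (t / 2) * 2 := mul_le_mul_of_nonneg_left hte (by positivity)
      _ ≤ 4 * r * Δ * Real.exp (t / 2) := by nlinarith [mul_nonneg (mul_nonneg hr0 hΔ0) e2.le]
  have hP3 : |8 / s₂ ^ 2 * Real.exp (t / s₂) * (h (t / s₁) - h (t / s₂))| ≤ 4 * r * Δ * Real.exp (t / 2) := by
    rw [abs_mul, abs_mul, abs_of_pos (by positivity : (0 : ℝ) < 8 / s₂ ^ 2), abs_of_pos (Real.exp_pos _)]
    have hmv := sub_abs_le_of_deriv hd hD ht2 ha hb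
    have hmv' : |h (t / s₁) - h (t / s₂)| ≤ r * Real.exp (t / 4) * (4 / 9 * |t| * Δ) := by
      rw [show t / 2 / 2 = t / 4 by ring] at hmv
      exact hmv.trans (mul_le_mul_of_nonneg_left hab (by positivity))
    calc 8 / s₂ ^ 2 * Real.exp (t / s₂) * |h (t / s₁) - h (t / s₂)|
        ≤ 32 / 9 * Real.exp (t / 2) * (r * Real.exp (t / 4) * (4 / 9 * |t| * Δ)) :=
          mul_le_mul (mul_le_mul h49 hex₂ (Real.exp_pos _).le (by norm_num)) hmv' (abs_nonneg _)
            (by positivity)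
      _ = 128 / 81 * r * Δ * Real.exp (t / 2) * (|t| * Real.exp (t / 4)) := by ring
      _ ≤ 128 / 81 * r * Δ * Real.exp (t / 2) * 2 := mul_le_mul_of_nonneg_left hte (by positivity)
      _ ≤ 4 * r * Δ * Real.exp (t / 2) := by nlinarith [mul_nonneg (mul_nonneg hr0 hΔ0) e2.le]
  calc _ ≤ |8 * (1 / s₁ ^ 2 - 1 / s₂ ^ 2) * (Real.exp (t / s₁) * h (t / s₁)) +
        8 / s₂ ^ 2 * (Real.exp (t / s₁) - Real.exp (t / s₂)) * h (t / s₁)| +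
        |8 / s₂ ^ 2 * Real.exp (t / s₂) * (h (t / s₁) - h (t / s₂))| := abs_add_le _ _
    _ ≤ |8 * (1 / s₁ ^ 2 - 1 / s₂ ^ 2) * (Real.exp (t / s₁) * h (t / s₁))| +
        |8 / s₂ ^ 2 * (Real.exp (t / s₁) - Real.exp (t / s₂)) * h (t / s₁)| +
        |8 / s₂ ^ 2 * Real.exp (t / s₂) * (h (t / s₁) - h (t / s₂))| := by
          linarith [abs_add_le (8 * (1 / s₁ ^ 2 - 1 / s₂ ^ 2) * (Real.exp (t / s₁) * h (t / s₁)))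
            (8 / s₂ ^ 2 * (Real.exp (t / s₁) - Real.exp (t / s₂)) * h (t / s₁))]
    _ ≤ 8 * r * Δ * Real.exp (t / 2) + 4 * r * Δ * Real.exp (t / 2) + 4 * r * Δ * Real.exp (t / 2) :=
          add_le_add (add_le_add hP1 hP2) hP3
    _ = 16 * r * Δ * Real.exp (t / 2) := by ring

end WakeRatchetRelayDilationLipschitz

end Summit.NavierStokesRegularity.NavierStokesRegularity.Theorems

end
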